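import Summits.Schanuel.Schanuel.Theorems.ZilberEacParamSurfaceAll
import HarnessLib

/-!
# Polynomially parametrised base curves, XX: the mirror statements for non-split surfaces
# (`deg g₁ < deg g₀`, two `y₀`-degrees) by the index swap

HONEST FRAMING.  Cell `pub-schanuel` (Zilber's Exponential-Algebraic Closedness, case ladder;
host summit Schanuel), seat 2, gen 19.  Bookkeeping: `S(g₀, g₁; Q)` is the index swap
(`EACDensityTransport.indexSwapped`, `x₀ ↔ x₁`, `y₀ ↔ y₁`) of `S(g₁, g₀; Q^σ)` with
`Q^σ(t; y₀, y₁) = Q(t; y₁, y₀)`, and `UnprojectedDense` is invariant (seat 1's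
`unprojectedDense_indexSwapped_iff`); so file XIX's theorem also covers `1 ≤ deg g₁ < deg g₀` with
two `y₀`-degrees.  Instances of Mantova–Masser's OPEN question (PLMS 2024 §1 p. 5); NOT Schanuel's
conjecture (neither used nor implied; EAC ⇏ SC); `EC(3,2)` stays OPEN.
-/

noncomputable section

open Complex MvPolynomial
open Literature.NumberTheory.Transcendental Literature.ModelTheory.Zilber
open Literature.ModelTheory.ExponentialFields

set_option linter.dupNamespace false

namespace Summit.Schanuel.Schanuel.Theorems

/-- `S(g₀, g₁; Q)` is the index swap of `S(g₁, g₀; Q^σ)`, `Q^σ = Q ∘ (y₀ ↔ y₁)`. -/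
theorem paramSurface₃_eq_indexSwapped (g₀ g₁ : Polynomial ℂ) (Q : MvPolynomial (Fin 3) ℂ) :
    {w : Fin 2 ⊕ Fin 2 → ℂ | ∃ t : ℂ, w (Sum.inl 0) = g₀.eval t ∧ w (Sum.inl 1) = g₁.eval t ∧
      MvPolynomial.eval (Fin.cases t (fun i => w (Sum.inr i)) : Fin 3 → ℂ) Q = 0} =
    indexSwapped {w : Fin 2 ⊕ Fin 2 → ℂ | ∃ t : ℂ, w (Sum.inl 0) = g₁.eval t ∧
      w (Sum.inl 1) = g₀.eval t ∧
      MvPolynomial.eval (Fin.cases t (fun i => w (Sum.inr i)) : Fin 3 → ℂ)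
        (rename (Equiv.swap (1 : Fin 3) 2) Q) = 0} := by
  ext w
  simp only [Set.mem_setOf_eq, mem_indexSwapped_iff, Function.comp_apply, idxSwap_inl_zero,
    idxSwap_inl_one, eval_rename]
  have e : ∀ t : ℂ, ((Fin.cases t (fun i => w (idxSwap (Sum.inr i))) : Fin 3 → ℂ) ∘
      (Equiv.swap (1 : Fin 3) 2)) = (Fin.cases t (fun i => w (Sum.inr i)) : Fin 3 → ℂ) := by
    intro t
    funext i
    fin_cases i
    · rfl
    · show (Fin.cases t (fun i => w (idxSwap (Sum.inr i))) : Fin 3 → ℂ)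
          (Equiv.swap (1 : Fin 3) 2 1) = _
      rw [Equiv.swap_apply_left]
      show w (idxSwap (Sum.inr 1)) = w (Sum.inr 0)
      rw [idxSwap_inr_one]
    · show (Fin.cases t (fun i => w (idxSwap (Sum.inr i))) : Fin 3 → ℂ)
          (Equiv.swap (1 : Fin 3) 2 2) = _
      rw [Equiv.swap_apply_right]
      show w (idxSwap (Sum.inr 0)) = w (Sum.inr 1)
      rw [idxSwap_inr_zero]
  constructor
  · rintro ⟨t, h0, h1, hQ⟩
    exact ⟨t, h1, h0, by rw [e t]; exact hQ⟩
  · rintro ⟨t, h1, h0, hQ⟩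
    exact ⟨t, h0, h1, by rw [← e t]; exact hQ⟩

/-- `Q^σ` is irreducible with `Q`. -/
theorem irreducible_rename_swap12 {Q : MvPolynomial (Fin 3) ℂ} (hirr : Irreducible Q) :
    Irreducible (rename (Equiv.swap (1 : Fin 3) 2) Q) :=
  (MulEquiv.irreducible_iff (renameEquiv ℂ (Equiv.swap (1 : Fin 3) 2)).toMulEquiv).2 hirr

/-- Two `y₀`-degrees of `Q` give two `y₁`-degrees of `Q^σ`. -/
theorem exists_support_rename_swap12 {Q : MvPolynomial (Fin 3) ℂ}
    (h2 : ∃ m ∈ Q.support, ∃ m' ∈ Q.support, m 1 ≠ m' 1) :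
    ∃ m ∈ (rename (Equiv.swap (1 : Fin 3) 2) Q).support,
      ∃ m' ∈ (rename (Equiv.swap (1 : Fin 3) 2) Q).support, m 2 ≠ m' 2 := by
  classical
  obtain ⟨m, hm, m', hm', hne⟩ := h2
  have hinj : Function.Injective (Equiv.swap (1 : Fin 3) 2) := (Equiv.swap (1 : Fin 3) 2).injective
  refine ⟨Finsupp.mapDomain (Equiv.swap (1 : Fin 3) 2) m, ?_,
    Finsupp.mapDomain (Equiv.swap (1 : Fin 3) 2) m', ?_, ?_⟩
  · rw [support_rename_of_injective hinj]; exact Finset.mem_image_of_mem _ hm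
  · rw [support_rename_of_injective hinj]; exact Finset.mem_image_of_mem _ hm'
  · have h1 : Finsupp.mapDomain (Equiv.swap (1 : Fin 3) 2) m 2 = m 1 := by
      have h := Finsupp.mapDomain_apply hinj m 1
      rwa [Equiv.swap_apply_left] at h
    have h1' : Finsupp.mapDomain (Equiv.swap (1 : Fin 3) 2) m' 2 = m' 1 := by
      have h := Finsupp.mapDomain_apply hinj m' 1
      rwa [Equiv.swap_apply_left] at h
    rw [h1, h1']; exact hne

/-- Torus fibres transfer under `y₀ ↔ y₁`. -/
theorem torusFibres_rename_swap12 {Q : MvPolynomial (Fin 3) ℂ}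
    (hfib : Set.Infinite {t : ℂ | ∃ c : Fin 2 → ℂ, c 0 ≠ 0 ∧ c 1 ≠ 0 ∧
      MvPolynomial.eval ![t, c 0, c 1] Q = 0}) :
    Set.Infinite {t : ℂ | ∃ c : Fin 2 → ℂ, c 0 ≠ 0 ∧ c 1 ≠ 0 ∧
      MvPolynomial.eval ![t, c 0, c 1] (rename (Equiv.swap (1 : Fin 3) 2) Q) = 0} := by
  refine hfib.mono ?_
  rintro t ⟨c, h0, h1, hc⟩
  refine ⟨![c 1, c 0], by simpa using h1, by simpa using h0, ?_⟩
  rw [eval_rename]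
  have e : ((![t, (![c 1, c 0] : Fin 2 → ℂ) 0, (![c 1, c 0] : Fin 2 → ℂ) 1] : Fin 3 → ℂ) ∘
      (Equiv.swap (1 : Fin 3) 2)) = ![t, c 0, c 1] := by
    funext i
    fin_cases i
    · rfl
    · show (![t, c 1, c 0] : Fin 3 → ℂ) (Equiv.swap (1 : Fin 3) 2 1) = c 0
      rw [Equiv.swap_apply_left]; rfl
    · show (![t, c 1, c 0] : Fin 3 → ℂ) (Equiv.swap (1 : Fin 3) 2 2) = c 1
      rw [Equiv.swap_apply_right]; rfl
  simp only [Matrix.cons_val_zero, Matrix.cons_val_one, Matrix.cons_val_fin_one] at e ⊢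
  rw [e]; exact hc

/-- **MAIN THEOREM, mirror (`1 ≤ deg g₁ < deg g₀`, two `y₀`-degrees).**  `Q` irreducible with two
monomials of different `y₀`-degree ⟹ the exponential points of `S(g; Q)` are Zariski dense.
[cite: MantovaMasser2023, §1 Further remarks, p. 5 (the question, open in general)] (new) -/
theorem unprojectedDense_paramSurface₃_of_gt (g₀ g₁ : Polynomial ℂ) (hg₁ : 1 ≤ g₁.natDegree)
    (hlt : g₁.natDegree < g₀.natDegree) {Q : MvPolynomial (Fin 3) ℂ} (hirr : Irreducible Q)
    (h2 : ∃ m ∈ Q.support, ∃ m' ∈ Q.support, m 1 ≠ m' 1) :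
    UnprojectedDense {w : Fin 2 ⊕ Fin 2 → ℂ | ∃ t : ℂ, w (Sum.inl 0) = g₀.eval t ∧
      w (Sum.inl 1) = g₁.eval t ∧
      MvPolynomial.eval (Fin.cases t (fun i => w (Sum.inr i)) : Fin 3 → ℂ) Q = 0} := by
  rw [paramSurface₃_eq_indexSwapped, unprojectedDense_indexSwapped_iff]
  exact unprojectedDense_paramSurface₃ g₁ g₀ hg₁ hlt (irreducible_rename_swap12 hirr)
    (exists_support_rename_swap12 h2)

/-- **Case ∧ dense, mirror.** [cite: MantovaMasser2023, §1 Further remarks, p. 5] (new) -/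
theorem unprojectedDensityQuestion_instance_paramSurface₃_of_gt (g₀ g₁ : Polynomial ℂ)
    (hg₁ : 1 ≤ g₁.natDegree) (hlt : g₁.natDegree < g₀.natDegree) {Q : MvPolynomial (Fin 3) ℂ}
    (hirr : Irreducible Q) (h2 : ∃ m ∈ Q.support, ∃ m' ∈ Q.support, m 1 ≠ m' 1)
    (hfib : Set.Infinite {t : ℂ | ∃ c : Fin 2 → ℂ, c 0 ≠ 0 ∧ c 1 ≠ 0 ∧
      MvPolynomial.eval ![t, c 0, c 1] Q = 0}) :
    MMCaseDimPiOneFree {w : Fin 2 ⊕ Fin 2 → ℂ | ∃ t : ℂ, w (Sum.inl 0) = g₀.eval t ∧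
        w (Sum.inl 1) = g₁.eval t ∧
        MvPolynomial.eval (Fin.cases t (fun i => w (Sum.inr i)) : Fin 3 → ℂ) Q = 0} ∧
      UnprojectedDense {w : Fin 2 ⊕ Fin 2 → ℂ | ∃ t : ℂ, w (Sum.inl 0) = g₀.eval t ∧
        w (Sum.inl 1) = g₁.eval t ∧
        MvPolynomial.eval (Fin.cases t (fun i => w (Sum.inr i)) : Fin 3 → ℂ) Q = 0} := by
  refine ⟨?_, unprojectedDense_paramSurface₃_of_gt g₀ g₁ hg₁ hlt hirr h2⟩
  rw [paramSurface₃_eq_indexSwapped]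
  exact mmCaseDimPiOneFree_indexSwapped
    (mmCase_paramSurface₃ g₁ g₀ hg₁ (paramCurve_indep_of_ne g₁ g₀ hg₁ (by omega) (by omega))
      (irreducible_rename_swap12 hirr) (torusFibres_rename_swap12 hfib))

end Summit.Schanuel.Schanuel.Theorems
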